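/-
Copyright (c) 2026 the pub-hodgecm-mathlib formalisation cell (harness21).  Prover seat hodgecm-mathlib-F0P3a-p07 (g14): «S3-ram» seeding wave (LEAD F0P3a-plan (g12);
owner F0P3a-p06 (g15)), (T2) G-side organ (Cnt2), repair of the `hCnt` keying of ★ p847470∕p847471 (the factor `τ_v·D_v` is μ-dependent near `1`); 2026-09-02.
-/
import Literature.NumberTheory.Rogawski1990.FinExplicitTransferFactorRamifiedLiterals      -- ★ `finTau_mul_finWeylRatio_eq_of_finExplicitDelta_eq`; brings ★ `exists_nhds_one_forall_finExplicitDelta_eq_hilbertSymbol_mul` (DeepTauTamePairs)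
import Literature.NumberTheory.Rogawski1990.FinExplicitTransferFactorNondegenerate         -- ★ `isUnit_eval_finCharpolyTwo_of_isLocalGRegular`, `finKappaAt_eq_one_or_eq_neg_one_of_isUnit`-family
import Literature.NumberTheory.Rogawski1990.UnitFundamentalLemmaInertFlickerFrame          -- ★ `isUnit_two_integer_iff_valued_eq_one`
import HarnessLib

/-!
# The depth token, the symmetrised discriminant and the scalar `τ_v·D_{G∕H,v} = (β, θ)_v · q_v^{−m}` near `1 ∈ H_v`, POPULATION-FREE, at a tame non-split place
# (Rogawski 1990 §4.9 p. 55, Lemma 4.9.3 p. 56; Labesse–Langlands 1979 §2)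

Topic `NumberTheory/Rogawski1990`; namespace `Literature.NumberTheory.Rogawski1990`.  THEOREMS ONLY (no definition, no named fact, no instance, no notation, no `sorry`).
Cell `pub/hodgecm-mathlib`, crux H413 (`--supports stmt-HodgeConjecture-24833`), «S3-ram» seeding wave (Literature seeding, count-neutral).

WHY THIS FILE.  The (T2) G-side assembly ★ p847470∕p847471 (`typeTwo_GSideNhds_{even,odd}_ram_of_literals_of_signedCounts`) keys its count socket `hCnt` per `γ_H` on the
EXPLICIT 2-deep tube and carries the factor `finTau L v γH μ * finWeylRatio L v γH` inside it.  That factor is NOT determined by `γ_H` on a fixed tube: `τ_v(γ_H, μ) =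
μ_w(u)·μ_w(−χ_g(u)∕det g)⁻¹` depends on the conductor of `μ_w` (★ `exists_forall_finTau_eq_hilbertSymbol_of_deep` evaluates it only `M₀(μ)`-deep), so a count law carrying it
cannot be proved for all admissible `μ`.  The type-(1) ★ design (★ `typeOne_GSideExplicit_ram_of_tokens_of_literals_of_signedClassSum{,Base}`) avoids this by choosing
`V := V_Δ(μ) ∩ …` and keeping its sockets μ-FREE.  The three theorems below are exactly what a μ-free re-keying of `hCnt` needs, for EVERY `G`-regular `γ_H` near `1` (no torus
type, no root ∕ rootless hypothesis):
* §1 `tokens_ram_of_isLocalGRegular` — `∃ V ∈ 𝓝 1, ∀ γ_H ∈ V`, `G`-regular: the depth token `∃ m, |χ_g(u)_w| = |ι_w ϖ_v|^m` AND the symmetrised discriminant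
  `∃ β ∈ (L⁺_v)ˣ, ι_w β = −χ_g(u)_w (u_w² + det g_w)∕(2u_w² det g_w)` (the proof of ★ `typeOne_tokens_ram` never used its two population hypotheses);
* §2 `exists_nhds_one_forall_finTau_mul_finWeylRatio_eq` — `∃ V ∈ 𝓝 1` (μ-DEPENDENT), `∀ γ_H ∈ V`, for every depth token `m`, every such `β` and every matched `t` with
  `κ_v(γ_H, t) = ±1`: **`τ_v(γ_H, μ)·D_v(γ_H) = (β, θ)_v · (q_v^m)⁻¹`**, `q_v = N(v) = Ideal.absNorm v` (★ `exists_nhds_one_forall_finExplicitDelta_eq_hilbertSymbol_mul` read through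
  ★ `finTau_mul_finWeylRatio_eq_of_finExplicitDelta_eq`; `Nat.card (𝓞 ⧸ v) = Ideal.absNorm v` by `Ideal.absNorm_apply`);
* §3 `exists_nhds_one_forall_tokens_finTau_mul_finWeylRatio_eq` — both at once on ONE neighbourhood: `∀ γ_H ∈ V`, `G`-regular: `∃ m β`, token ∧ discriminant ∧ the scalar law
  for every matched `t` with `κ = ±1`.
HONEST LABEL: HC_CM is proved only modulo the 2 remaining named inputs (hLiu418 24832, h413 24833) until rung 0 closes; no books consequence.

## References
* [Rogawski1990] J. D. Rogawski, *Automorphic Representations of Unitary Groups in Three Variables*, Ann. of Math. Stud. 123 (1990), §4.9 p. 55 (`τ`, `D_{G∕H}`),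
  Lemma 4.9.3 (4.9.2) p. 56, §4.3 (4.3.1) p. 43, Prop. 8.1.3 p. 116.
* [LabesseLanglands1979] J.-P. Labesse, R. P. Langlands, *L-indistinguishability for SL(2)*, Canad. J. Math. 31 (1979), §2 (2.1)–(2.2).
-/

set_option autoImplicit false

noncomputable section

open NumberField IsDedekindDomain Matrix Filter Topology Polynomial
open scoped MatrixGroups ValuativeRel

namespace Literature.NumberTheory.Rogawski1990

open Literature.NumberTheory.Automorphic Literature.NumberTheory.Automorphic.UnitaryGroup
open Literature.NumberTheory.GaloisRepresentations Literature.NumberTheory.NumberFields Literature.NumberTheory.QuadraticForms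

variable (L : Type) [Field L] [NumberField L] [IsCMField L] (v : HeightOneSpectrum (𝓞 ↥(maximalRealSubfield L)))
  (w : PlacesOver L v) (hw : IsCMField.complexConj L • w.1 = w.1)

/-! ## §1 The depth token and the symmetrised discriminant near `1`, for every `G`-regular `γ_H` -/

include hw in
/-- **TOKENS, POPULATION-FREE.**  At a non-split place `w ∣ v` with `|2|_w = 1` there is `V ∈ 𝓝 (1 : H_v)` such that every `G`-regular `γ_H ∈ V` has a depth token
`m` (`|χ_g(u)_w| = |ι_w ϖ_v|^m`) and a symmetrised discriminant `β ∈ (L⁺_v)ˣ` (`ι_w β = −χ_g(u)_w (u_w² + det g_w)∕(2u_w² det g_w)`).  `V` = the neighbourhood where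
`|u_w − 1|, |det g_w − 1| ≤ |ι_w ϖ_v|` and `|χ_g(u)_w| < 1` (★ `eventually_nhds_one_valued_sub_one_le`, ★ `eventually_nhds_one_valued_eval_lt_one`); `χ_g(u)_w ≠ 0` by
`G`-regularity.  Same proof as ★ `typeOne_tokens_ram`, whose root ∕ non-Levi hypotheses were not used. [cite: Rogawski1990, §4.9 p. 55, Lemma 4.9.3 p. 56]
[cite: LabesseLanglands1979, §2 (2.1)] -/
theorem tokens_ram_of_isLocalGRegular (h2 : IsUnit (2 : 𝒪[(w.1.adicCompletion L)])) :
    ∃ V ∈ 𝓝 (1 : ((cmDatum L 2 (Matrix.of fun i j : Fin 2 => if i.val + j.val + 1 = 2 then (1 : L) else 0)).Local v ×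
        (cmDatum L 1 (Matrix.of fun i j : Fin 1 => if i.val + j.val + 1 = 1 then (1 : L) else 0)).Local v)),
      ∀ γH ∈ V, IsLocalGRegular L v γH →
        (∃ m : ℕ, Valued.v (((finCharpolyTwo L v γH).eval (finGammaTwo L v γH)) w) =
          Valued.v ((toPlace v w (HeckeCharacter.uniformizer ↥(maximalRealSubfield L) v : v.adicCompletion ↥(maximalRealSubfield L))) ^ m)) ∧
        ∃ β : (v.adicCompletion ↥(maximalRealSubfield L))ˣ, toPlace v w (β : v.adicCompletion ↥(maximalRealSubfield L)) =
            -(((finCharpolyTwo L v γH).eval (finGammaTwo L v γH)) w *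
                (finGammaTwo L v γH w ^ 2 +
                  ((γH.1.val.val : Matrix (Fin 2) (Fin 2) (UnitaryGroup.LocalRing L v)).map
                    (Pi.evalRingHom (fun w' : UnitaryGroup.PlacesOver L v => w'.1.adicCompletion L) w)).det)) /
              (2 * finGammaTwo L v γH w ^ 2 *
                ((γH.1.val.val : Matrix (Fin 2) (Fin 2) (UnitaryGroup.LocalRing L v)).map
                    (Pi.evalRingHom (fun w' : UnitaryGroup.PlacesOver L v => w'.1.adicCompletion L) w)).det) := by
  have h2v : Valued.v (2 : w.1.adicCompletion L) = 1 := (isUnit_two_integer_iff_valued_eq_one L w.1).1 h2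
  have hϖ0 : (toPlace v w (HeckeCharacter.uniformizer ↥(maximalRealSubfield L) v : v.adicCompletion ↥(maximalRealSubfield L))) ^ 1 ≠ 0 :=
    pow_ne_zero _ (toPlace_heckeUniformizer_ne_zero L v w)
  refine (Filter.Eventually.exists_mem ?_)
  filter_upwards [eventually_nhds_one_valued_sub_one_le L v w hϖ0, eventually_nhds_one_valued_eval_lt_one L v w] with γH hγ hχ hreg
  have hunit : IsUnit ((finCharpolyTwo L v γH).eval (finGammaTwo L v γH)) := isUnit_eval_finCharpolyTwo_of_isLocalGRegular L v γH hreg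
  have hχ0 : ((finCharpolyTwo L v γH).eval (finGammaTwo L v γH)) w ≠ 0 :=
    (hunit.map (Pi.evalRingHom (fun w' : PlacesOver L v => w'.1.adicCompletion L) w)).ne_zero
  obtain ⟨β, hβ⟩ := exists_units_toPlace_eq_symmDisc_of_deep L v w hw h2v le_rfl γH hχ0 hγ.1 hγ.2
  exact ⟨⟨_, valued_eval_eq_valued_toPlace_pow_toNat_of_toPlace_eq L v w h2v le_rfl γH hγ.1 hγ.2 hχ.le β hβ⟩, β, hβ⟩

/-! ## §2 The scalar `τ_v · D_{G∕H,v} = (β, θ)_v · q_v^{−m}` near `1` (the neighbourhood depends on `μ`) -/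

section Scalar

variable (μ : HeckeCharacter L)
  (hμω : ∀ x : ideleGroup ↥(maximalRealSubfield L), μ (AdeleRing.ideleBaseChange ↥(maximalRealSubfield L) L x) = quadraticHeckeCharCM L x)

omit [IsCMField L] in
/-- `Nat.card (𝓞_{L⁺} ⧸ v) = Ideal.absNorm v` as complex numbers (spelling bridge between ★ `exists_nhds_one_forall_finExplicitDelta_eq_hilbertSymbol_mul` and the fold's `q`).
[cite: Rogawski1990, §4.9 p. 55] -/
theorem natCard_quot_eq_absNorm_cast :
    ((Nat.card (𝓞 ↥(maximalRealSubfield L) ⧸ v.asIdeal) : ℂ)) = (Ideal.absNorm v.asIdeal : ℂ) := by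
  rw [Ideal.absNorm_apply, Submodule.cardQuot_apply]

include hw hμω in
/-- **THE SCALAR NEAR `1`.**  At a non-split place `w ∣ v` with `|2|_w = 1`, under print's guard `μ|_{𝕀_{L⁺}} = ω`: there is `V ∈ 𝓝 (1 : H_v)` (depending on `μ`) such that for every
`γ_H ∈ V`, every depth token `m` (`|χ_g(u)_w| = |ι_w ϖ_v|^m`), every symmetrised discriminant `β` and every `t ∈ G′_v` matched with `γ_H` with `κ_v(γ_H, t) = ±1`:
**`τ_v(γ_H, μ) · D_{G∕H,v}(γ_H) = (β, θ)_v · (N v)^{−m}`**.  (★ `exists_nhds_one_forall_finExplicitDelta_eq_hilbertSymbol_mul`: `Δ‴ = (β, θ)_v q^{−m} κ`; ★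
`finTau_mul_finWeylRatio_eq_of_finExplicitDelta_eq`: divide by `κ ≠ 0`.) [cite: Rogawski1990, §4.9 p. 55; §4.3 (4.3.1) p. 43; Prop. 8.1.3 p. 116]
[cite: LabesseLanglands1979, §2 (2.1)–(2.2)] -/
theorem exists_nhds_one_forall_finTau_mul_finWeylRatio_eq (h2 : IsUnit (2 : 𝒪[(w.1.adicCompletion L)])) (H' : Matrix (Fin 3) (Fin 3) L) :
    ∃ V ∈ 𝓝 (1 : ((cmDatum L 2 (Matrix.of fun i j : Fin 2 => if i.val + j.val + 1 = 2 then (1 : L) else 0)).Local v ×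
        (cmDatum L 1 (Matrix.of fun i j : Fin 1 => if i.val + j.val + 1 = 1 then (1 : L) else 0)).Local v)),
      ∀ γH ∈ V, ∀ (m : ℕ),
        Valued.v (((finCharpolyTwo L v γH).eval (finGammaTwo L v γH)) w) =
          Valued.v ((toPlace v w (HeckeCharacter.uniformizer ↥(maximalRealSubfield L) v : v.adicCompletion ↥(maximalRealSubfield L))) ^ m) →
        ∀ β : (v.adicCompletion ↥(maximalRealSubfield L))ˣ,
          toPlace v w (β : v.adicCompletion ↥(maximalRealSubfield L)) =
            -(((finCharpolyTwo L v γH).eval (finGammaTwo L v γH)) w *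
                (finGammaTwo L v γH w ^ 2 +
                  ((γH.1.val.val : Matrix (Fin 2) (Fin 2) (LocalRing L v)).map (Pi.evalRingHom (fun w' : PlacesOver L v => w'.1.adicCompletion L) w)).det)) /
              (2 * finGammaTwo L v γH w ^ 2 *
                ((γH.1.val.val : Matrix (Fin 2) (Fin 2) (LocalRing L v)).map (Pi.evalRingHom (fun w' : PlacesOver L v => w'.1.adicCompletion L) w)).det) →
        ∀ t : (cmDatum L 3 H').Local v, IsLocalNormPair L H' v γH t →
          (finKappaAt L v H' γH t = 1 ∨ finKappaAt L v H' γH t = -1) →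
          finTau L v γH μ * (finWeylRatio L v γH : ℂ) =
            (hilbertSymbol (v.adicCompletion ↥(maximalRealSubfield L)) (β : v.adicCompletion ↥(maximalRealSubfield L))
                (algebraMap ↥(maximalRealSubfield L) _ ((cmQuadraticGenerator L : 𝓞 ↥(maximalRealSubfield L)) : ↥(maximalRealSubfield L))) : ℂ) *
              ((Ideal.absNorm v.asIdeal : ℂ) ^ m)⁻¹ := by
  have h2v : Valued.v (2 : w.1.adicCompletion L) = 1 := (isUnit_two_integer_iff_valued_eq_one L w.1).1 h2
  obtain ⟨V, hV, hD⟩ := exists_nhds_one_forall_finExplicitDelta_eq_hilbertSymbol_mul L v w hw μ hμω h2v H'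
  refine ⟨V, hV, fun γH hγ m hm β hβ t ht hκ => ?_⟩
  rw [← natCard_quot_eq_absNorm_cast L v]
  rcases hκ with hκ | hκ
  · exact finTau_mul_finWeylRatio_eq_of_finExplicitDelta_eq L v H' μ γH ht (Or.inl rfl) hκ (hD γH hγ m t hm β hβ ht)
  · exact finTau_mul_finWeylRatio_eq_of_finExplicitDelta_eq L v H' μ γH ht (Or.inr rfl) hκ (hD γH hγ m t hm β hβ ht)

/-! ## §3 Both at once on one neighbourhood -/

include hw hμω in
/-- **TOKENS AND SCALAR ON ONE NEIGHBOURHOOD.**  At a non-split place `w ∣ v` with `|2|_w = 1`, under `μ|_{𝕀_{L⁺}} = ω`: there is `V ∈ 𝓝 (1 : H_v)` such that every `G`-regular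
`γ_H ∈ V` has a depth token `m` and a symmetrised discriminant `β` for which `τ_v(γ_H, μ)·D_v(γ_H) = (β, θ)_v · (N v)^{−m}` on every matched `t` with `κ_v(γ_H, t) = ±1`
(§1 ∩ §2).  This is the μ-free∕μ-dependent split the (T2) assembly wants: choose `V` here, hand `m, β` to a μ-FREE count socket.
[cite: Rogawski1990, §4.9 p. 55, Lemma 4.9.3 p. 56; §4.3 (4.3.1) p. 43] [cite: LabesseLanglands1979, §2 (2.1)–(2.2)] -/
theorem exists_nhds_one_forall_tokens_finTau_mul_finWeylRatio_eq (h2 : IsUnit (2 : 𝒪[(w.1.adicCompletion L)])) (H' : Matrix (Fin 3) (Fin 3) L) :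
    ∃ V ∈ 𝓝 (1 : ((cmDatum L 2 (Matrix.of fun i j : Fin 2 => if i.val + j.val + 1 = 2 then (1 : L) else 0)).Local v ×
        (cmDatum L 1 (Matrix.of fun i j : Fin 1 => if i.val + j.val + 1 = 1 then (1 : L) else 0)).Local v)),
      ∀ γH ∈ V, IsLocalGRegular L v γH →
        ∃ (m : ℕ) (β : (v.adicCompletion ↥(maximalRealSubfield L))ˣ),
          Valued.v (((finCharpolyTwo L v γH).eval (finGammaTwo L v γH)) w) =
            Valued.v ((toPlace v w (HeckeCharacter.uniformizer ↥(maximalRealSubfield L) v : v.adicCompletion ↥(maximalRealSubfield L))) ^ m) ∧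
          toPlace v w (β : v.adicCompletion ↥(maximalRealSubfield L)) =
            -(((finCharpolyTwo L v γH).eval (finGammaTwo L v γH)) w *
                (finGammaTwo L v γH w ^ 2 +
                  ((γH.1.val.val : Matrix (Fin 2) (Fin 2) (LocalRing L v)).map (Pi.evalRingHom (fun w' : PlacesOver L v => w'.1.adicCompletion L) w)).det)) /
              (2 * finGammaTwo L v γH w ^ 2 *
                ((γH.1.val.val : Matrix (Fin 2) (Fin 2) (LocalRing L v)).map (Pi.evalRingHom (fun w' : PlacesOver L v => w'.1.adicCompletion L) w)).det) ∧
          ∀ t : (cmDatum L 3 H').Local v, IsLocalNormPair L H' v γH t →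
            (finKappaAt L v H' γH t = 1 ∨ finKappaAt L v H' γH t = -1) →
            finTau L v γH μ * (finWeylRatio L v γH : ℂ) =
              (hilbertSymbol (v.adicCompletion ↥(maximalRealSubfield L)) (β : v.adicCompletion ↥(maximalRealSubfield L))
                  (algebraMap ↥(maximalRealSubfield L) _ ((cmQuadraticGenerator L : 𝓞 ↥(maximalRealSubfield L)) : ↥(maximalRealSubfield L))) : ℂ) *
                ((Ideal.absNorm v.asIdeal : ℂ) ^ m)⁻¹ := by
  obtain ⟨VT, hVT, hT⟩ := tokens_ram_of_isLocalGRegular L v w hw h2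
  obtain ⟨VD, hVD, hD⟩ := exists_nhds_one_forall_finTau_mul_finWeylRatio_eq L v w hw μ hμω h2 H'
  refine ⟨VT ∩ VD, Filter.inter_mem hVT hVD, fun γH hγ hreg => ?_⟩
  obtain ⟨⟨m, hm⟩, β, hβ⟩ := hT γH hγ.1 hreg
  exact ⟨m, β, hm, hβ, fun t ht hκ => hD γH hγ.2 m hm β hβ t ht hκ⟩

end Scalar

end Literature.NumberTheory.Rogawski1990
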